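import Summits.ResolutionOfSingularities.ResolutionOfSingularities.Theorems.FrobeniusLadderFRationalResolutionFixedPointBlowupRegularVeronese
import Summits.ResolutionOfSingularities.ResolutionOfSingularities.Theorems.FrobeniusLadderFRationalResolutionEtaleChartStalkBlowup
import HarnessLib

/-!
# Crux `FrobeniusLadder.FRationalResolution` (stmt-ResolutionOfSingularities-15317), line `redirect`,
# stub `stub_diagonalizableQuotientResolution` — **RESOLUTION OF VARIETIES WHOSE SINGULAR POINTS ARE ISOLATED DIAGONALIZABLE-QUOTIENT
# POINTS OF TYPE `1/r(1,…,1)`** (every field, every characteristic, twisted forms included; unconditional, no Galois data)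

Assembly of the fixed-point lane of this generation:
`…FixedPointBlowupRegularVeronese.isRegular_affineBlowup_maximalIdeal_of_sameDegree` (one blow-up of the local ring of the quotient
chart `Spec S₀` at the image of a fixed prime with equal-degree homogeneous parameters is regular) + `Spec.stalkIso` +
`…EtaleChartStalkBlowup.hasResolution_of_isolated_etale_stalkBlowup` (étale chart with regular stalk blow-up at each of finitely many
singular points ⇒ resolution):

* ★★★★★★ `hasResolution_of_isolated_sameDegree_fixedPoints` — `X` integral, locally of finite type over a field `k`, with finitely
  many singular points, each the image under an ÉTALE `φ : Spec S₀ → X` of the point `𝔔 ∩ S₀`, where `S` is an algebra of finite type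
  over a field `k'` graded by a torsion abelian group `A`, `S₀ = 𝒮 0`, and `𝔔 ⊇ S_a` (`a ≠ 0`) is a `D(A)`-fixed prime admitting
  homogeneous `x₁,…,x_n ∈ 𝔔` of ONE common degree generating `𝔪_{S_𝔔}` with `n = dim S_𝔔`. Then `X` HAS A RESOLUTION OF
  SINGULARITIES.
* `hloc_of_sameDegree_fixedPoint` — the per-point datum.

In the vocabulary of `stub_diagonalizableQuotientResolution`: its hypothesis `hq` restricted to varieties with isolated singularities
whose charts hit the singular points at fixed points of Veronese type (`𝔸ⁿ/μ_r` with weights `(1,…,1)` and all their twisted /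
non-rational forms) is DISCHARGED. Honest label: a sub-class of ONE leaf stub closed unconditionally; the stub, crux and summit are
not closed. No definitions, no named facts, no sorry. [cite: Kollar2007, §2.2] [cite: Kato1994, Thm. (3.2)]
[cite: Matsumura1987, Thm. 8.11; Thm. 23.7; §32 p. 256]
-/

noncomputable section

-- single-problem summit: the doubled namespace component is forced
set_option linter.dupNamespace false

open CategoryTheory AlgebraicGeometry TopologicalSpace IsLocalRing
open Literature.AlgebraicGeometry.Resolution

namespace Summit.ResolutionOfSingularities.ResolutionOfSingularities.Theorems.FRationalResolution.FixedPointResolution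

universe w

/-- **The stalk of the quotient chart at the image of a Veronese-type fixed point has a regular point blow-up.**
[cite: Kato1994, Thm. (3.2)] [cite: Kollar2007, §2.2] -/
theorem isRegular_affineBlowup_stalk_of_sameDegree {k' : Type} [Field k'] {A : Type w} [DecidableEq A] [AddCommGroup A]
    {S : Type} [CommRing S] [Algebra k' S] (𝒮 : A → Submodule k' S) [GradedAlgebra 𝒮] [Algebra.FiniteType k' S]
    (hA : AddMonoid.IsTorsion A) (𝔔 : Ideal S) [𝔔.IsPrime]
    (hfix : ∀ a : A, a ≠ 0 → ∀ s ∈ 𝒮 a, s ∈ 𝔔)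
    {n : ℕ} (x : Fin n → S) (a₀ : A) (hxa : ∀ i, x i ∈ 𝔔 ∧ x i ∈ 𝒮 a₀)
    (hspan : Ideal.span (algebraMap S (Localization.AtPrime 𝔔) '' Set.range x) =
      maximalIdeal (Localization.AtPrime 𝔔))
    (hn : (n : WithBot ℕ∞) = ringKrullDim (Localization.AtPrime 𝔔)) :
    Scheme.IsRegular (affineBlowup (maximalIdeal ((Spec (.of (𝒮 0))).presheaf.stalk
      (⟨𝔔.comap (algebraMap (𝒮 0) S), inferInstance⟩ : Spec (.of (𝒮 0)))))) := by
  have h := FixedPointBlowupRegular.isRegular_affineBlowup_maximalIdeal_of_sameDegree 𝒮 hA 𝔔 hfix x a₀ hxa hspan hn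
    (Localization.AtPrime (𝔔.comap (algebraMap (𝒮 0) S)))
  let e := (Spec.stalkIso (.of (𝒮 0))
    (⟨𝔔.comap (algebraMap (𝒮 0) S), inferInstance⟩ : Spec (.of (𝒮 0)))).commRingCatIsoToRingEquiv
  have h' := BlowupOrbitCentre.isRegular_affineBlowup_map_of_ringEquiv e.symm _ h
  rwa [PointBlowupOfCompletion.map_maximalIdeal_ringEquiv e.symm] at h'

/-- **`hloc` at an isolated singular point which is the image of a Veronese-type fixed point under an étale quotient chart.**
[cite: Kollar2007, §2.2] [cite: Kato1994, Thm. (3.2)] -/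
theorem hloc_of_sameDegree_fixedPoint (k : Type) [Field k] (X : Scheme.{0}) [IsIntegral X]
    (f : X ⟶ Spec (.of k)) [LocallyOfFiniteType f] (hfin : (Scheme.regularLocus X)ᶜ.Finite)
    {k' : Type} [Field k'] {A : Type w} [DecidableEq A] [AddCommGroup A]
    {S : Type} [CommRing S] [Algebra k' S] (𝒮 : A → Submodule k' S) [GradedAlgebra 𝒮] [Algebra.FiniteType k' S]
    (hA : AddMonoid.IsTorsion A) (φ : Spec (.of (𝒮 0)) ⟶ X) [Etale φ] (𝔔 : Ideal S) [𝔔.IsPrime]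
    (hfix : ∀ a : A, a ≠ 0 → ∀ s ∈ 𝒮 a, s ∈ 𝔔)
    {n : ℕ} (x : Fin n → S) (a₀ : A) (hxa : ∀ i, x i ∈ 𝔔 ∧ x i ∈ 𝒮 a₀)
    (hspan : Ideal.span (algebraMap S (Localization.AtPrime 𝔔) '' Set.range x) =
      maximalIdeal (Localization.AtPrime 𝔔))
    (hn : (n : WithBot ℕ∞) = ringKrullDim (Localization.AtPrime 𝔔))
    (hx : φ ⟨𝔔.comap (algebraMap (𝒮 0) S), inferInstance⟩ ∉ Scheme.regularLocus X) :
    ∃ (W : X.Opens), φ ⟨𝔔.comap (algebraMap (𝒮 0) S), inferInstance⟩ ∈ W ∧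
      (∀ t : X, t ∉ Scheme.regularLocus X → t ∈ W → t = φ ⟨𝔔.comap (algebraMap (𝒮 0) S), inferInstance⟩) ∧
      ∃ (Z : Scheme.{0}) (ρ : Z ⟶ W), IsProper ρ ∧ Scheme.IsRegular Z ∧
        IsIso (ρ ∣_ (W.ι ⁻¹ᵁ ⟨Scheme.regularLocus X, isOpen_regularLocus_of_locallyOfFiniteType_field f⟩)) ∧
        Dense ((ρ ⁻¹ᵁ (W.ι ⁻¹ᵁ ⟨Scheme.regularLocus X,
          isOpen_regularLocus_of_locallyOfFiniteType_field f⟩) : Z.Opens) : Set Z) :=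
  EtaleChartStalkBlowup.hloc_of_etale_chart_stalkBlowup k X f hfin φ _ hx
    (isRegular_affineBlowup_stalk_of_sameDegree 𝒮 hA 𝔔 hfix x a₀ hxa hspan hn)

/-- ★★★★★★ **RESOLUTION OF VARIETIES WITH ISOLATED QUOTIENT SINGULARITIES OF TYPE `1/r(1,…,1)` (all fields, all characteristics,
twisted forms included).** `X` integral, locally of finite type over a field `k`, with finitely many singular points, each the image
under an étale `φ : Spec S₀ → X` (`S` of finite type over a field `k'`, graded by a torsion group `A`, `S₀ = 𝒮 0`) of the contraction of
a `D(A)`-fixed prime `𝔔` with homogeneous `x₁,…,x_n ∈ 𝔔` of one common degree generating `𝔪_{S_𝔔}`, `n = dim S_𝔔`. Then `X` has a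
resolution of singularities. [cite: Kollar2007, §2.2] [cite: Kato1994, Thm. (3.2)] [cite: Matsumura1987, Thm. 8.11; Thm. 23.7] -/
theorem hasResolution_of_isolated_sameDegree_fixedPoints (k : Type) [Field k] (X : Scheme.{0}) [IsIntegral X]
    (f : X ⟶ Spec (.of k)) [LocallyOfFiniteType f] (hfin : (Scheme.regularLocus X)ᶜ.Finite)
    (hchart : ∀ t : X, t ∉ Scheme.regularLocus X →
      ∃ (k' : Type) (_ : Field k') (A : Type) (_ : DecidableEq A) (_ : AddCommGroup A) (_ : AddMonoid.IsTorsion A)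
        (S : Type) (_ : CommRing S) (_ : Algebra k' S) (𝒮 : A → Submodule k' S) (_ : GradedAlgebra 𝒮)
        (_ : Algebra.FiniteType k' S) (φ : Spec (.of (𝒮 0)) ⟶ X) (_ : Etale φ)
        (𝔔 : Ideal S) (_ : 𝔔.IsPrime) (_ : ∀ a : A, a ≠ 0 → ∀ s ∈ 𝒮 a, s ∈ 𝔔)
        (n : ℕ) (x : Fin n → S) (a₀ : A),
        (∀ i, x i ∈ 𝔔 ∧ x i ∈ 𝒮 a₀) ∧
        Ideal.span (algebraMap S (Localization.AtPrime 𝔔) '' Set.range x) = maximalIdeal (Localization.AtPrime 𝔔) ∧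
        (n : WithBot ℕ∞) = ringKrullDim (Localization.AtPrime 𝔔) ∧
        φ ⟨𝔔.comap (algebraMap (𝒮 0) S), inferInstance⟩ = t) :
    Scheme.HasResolution X := by
  refine EtaleChartStalkBlowup.hasResolution_of_isolated_etale_stalkBlowup k X f hfin fun t ht => ?_
  obtain ⟨k', _, A, _, _, hA, S, _, _, 𝒮, _, _, φ, hφ, 𝔔, _, hfix, n, x, a₀, hxa, hspan, hn, hφt⟩ := hchart t ht
  exact ⟨_, φ, hφ, _, hφt, isRegular_affineBlowup_stalk_of_sameDegree 𝒮 hA 𝔔 hfix x a₀ hxa hspan hn⟩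

end Summit.ResolutionOfSingularities.ResolutionOfSingularities.Theorems.FRationalResolution.FixedPointResolution

end
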